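import Mathlib
import HarnessLib
import Literature.Computability.AlgebraicComplexity.PatternExpressions
import Summits.ValiantsHypothesis.ValiantsHypothesis.Theorems.MonotoneRestorationOrbitCompressionQPMultiRowStratum

/-!
# Route MonotoneRestoration — aside `OrbitCompressionQP` (stmt-ValiantsHypothesis-18332), line
# `expression_compression`: the `k`-ROW STRATUM FROM A REPRESENTATION — the socket for a vector-symmetric
# Bläser–Jindal theorem

`Theorems/…MultiRowStratum.lean` proves the `k`-row stratum in polarised power-sum coordinates.  This file states
the stratum in the shape a future REPRESENTATION THEOREM plugs into (item 2 of this hand's remaining-lemma list: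
"a `VP` family of vector-symmetric polynomials `g_n ∈ ℂ[x_{a,v} : a < k, v < n]^{S_n}` has a representation
`g_n = Q_n(p_{α_{n,1}}, …, p_{α_{n,m(n)}})` in polarised power sums with `Q ∈ VQP` and p-bounded weights" — for
`k = 1` this is Bläser–Jindal + Newton; for `k ≥ 2` it is NOT in print):

* `aeval_rows_polarisedPowerSum` — substituting the rows `ρ` into `p_α` gives `p_α(rows ρ)`;
* ★ `narrowQP_multiRow_of_representation` — if `g_n` has such a representation then
  `f_n = Σ_{ρ : [k] → [n]} g_n(rows ρ(0), …, ρ(k-1))` is narrow of quasi-polynomial length.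

Helper file (`--supports stmt-ValiantsHypothesis-18332`); def-free; nothing here is a named fact; no registered
stub is closed; VP ≠ VNP is not moved.
-/

noncomputable section

open MvPolynomial

-- `Summit.ValiantsHypothesis.ValiantsHypothesis.…` is the tree's single-conjunct layout (Sub = Summit).
set_option linter.dupNamespace false

namespace Summit.ValiantsHypothesis.ValiantsHypothesis.Theorems

namespace FormulaSubstitution

open Literature.Computability.AlgebraicComplexity

/-- Substituting the rows `ρ` (`x_{a,v} ↦ x_{ρ a, v}`) into the polarised power sum
`p_α = Σ_v Π_a x_{a,v}^{α_a}` gives `p_α(rows ρ)`. [folklore] -/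
theorem aeval_rows_polarisedPowerSum {k n : ℕ} (ρ : Fin k → Fin n) (α : Fin k → ℕ) :
    aeval (fun av : Fin k × Fin n => (X (ρ av.1, av.2) : MvPolynomial (Fin n × Fin n) ℂ))
      (∑ v : Fin n, ∏ a : Fin k, (X (a, v) : MvPolynomial (Fin k × Fin n) ℂ) ^ α a) =
      ∑ v : Fin n, ∏ a : Fin k, (X (ρ a, v) : MvPolynomial (Fin n × Fin n) ℂ) ^ α a := by
  rw [map_sum]
  refine Finset.sum_congr rfl fun v _ => ?_
  rw [map_prod]
  refine Finset.prod_congr rfl fun a _ => ?_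
  rw [map_pow, aeval_X]

/-- ★ **The `k`-row stratum from a representation in polarised power sums.**  Let
`g_n ∈ ℂ[x_{a,v} : a < k, v < n]` and suppose `g_n = Q_n(p_{α_{n,0}}, …, p_{α_{n,m(n)-1}})` with `Q` a `VQP`
family and weights `|α_{n,j}| ≤ d n`, `d` p-bounded.  Then the matrix-symmetric family
`f_n = Σ_{ρ : [k] → [n]} g_n(x_{ρ a, v})` satisfies the conclusion of `stub_narrowExpressionCompression`.
For `k = 1` the hypothesis is supplied by Bläser–Jindal (`narrowQP_oneRow`); for `k ≥ 2` it is the open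
vector-symmetric representation problem. [cite: BurgisserClausenShokrollahi1997, Thm. (21.33)] -/
theorem narrowQP_multiRow_of_representation (k : ℕ) {m d : ℕ → ℕ} (hd : IsPBounded d)
    (g : (n : ℕ) → MvPolynomial (Fin k × Fin n) ℂ)
    (Q : (n : ℕ) → MvPolynomial (Fin (m n)) ℂ) (hQ : IsVQPFamily Q)
    (α : (n : ℕ) → Fin (m n) → Fin k → ℕ) (hα : ∀ n j, ∑ a, α n j a ≤ d n)
    (hrep : ∀ n, aeval (fun j : Fin (m n) =>
      ∑ v : Fin n, ∏ a : Fin k, (X (a, v) : MvPolynomial (Fin k × Fin n) ℂ) ^ α n j a) (Q n) = g n) :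
    ∃ c : ℕ, ∀ n : ℕ, 1 ≤ n → ∃ (k' l : ℕ) (e : PatternExpr ℂ k' l),
      n ^ (k' + l) ≤ 2 ^ ((Nat.log 2 n + c) ^ c) ∧ e.length ≤ 2 ^ ((Nat.log 2 n + c) ^ c) ∧
      e.close n = ∑ ρ : Fin k → Fin n,
        aeval (fun av : Fin k × Fin n => (X (ρ av.1, av.2) : MvPolynomial (Fin n × Fin n) ℂ)) (g n) := by
  obtain ⟨c, hc⟩ := narrowQP_multiRowPowerSumSubst k hd Q hQ α hα
  refine ⟨c, fun n hn => ?_⟩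
  obtain ⟨k', l, e, hkl, hlen, hclose⟩ := hc n hn
  refine ⟨k', l, e, hkl, hlen, ?_⟩
  rw [hclose]
  refine Finset.sum_congr rfl fun ρ _ => ?_
  rw [← hrep n]
  -- `aeval (rows ρ) ∘ aeval (p_α) = aeval (p_α(rows ρ))`, by induction on the outer polynomial
  have key : ∀ q : MvPolynomial (Fin (m n)) ℂ,
      aeval (fun av : Fin k × Fin n => (X (ρ av.1, av.2) : MvPolynomial (Fin n × Fin n) ℂ))
        (aeval (fun j : Fin (m n) =>
          ∑ v : Fin n, ∏ a : Fin k, (X (a, v) : MvPolynomial (Fin k × Fin n) ℂ) ^ α n j a) q) =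
      aeval (fun j : Fin (m n) =>
        ∑ v : Fin n, ∏ a : Fin k, (X (ρ a, v) : MvPolynomial (Fin n × Fin n) ℂ) ^ α n j a) q := by
    intro q
    induction q using MvPolynomial.induction_on with
    | C c => simp only [aeval_C, algebraMap_eq]
    | add p q hp hq => simp only [map_add, hp, hq]
    | mul_X p j hp => rw [map_mul, map_mul, map_mul, hp, aeval_X, aeval_X, aeval_rows_polarisedPowerSum]
  exact (key (Q n)).symm

/-- **The substituted row family is what one expects**: for `k = 1` the substitution `x_{0,v} ↦ x_{ρ 0, v}`
recovers `g_n(row ρ 0)` (sanity link with `narrowQP_oneRow`). [folklore] -/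
theorem aeval_rows_one {n : ℕ} (ρ : Fin 1 → Fin n) (g : MvPolynomial (Fin 1 × Fin n) ℂ) :
    aeval (fun av : Fin 1 × Fin n => (X (ρ av.1, av.2) : MvPolynomial (Fin n × Fin n) ℂ)) g =
      aeval (fun v : Fin n => (X (ρ 0, v) : MvPolynomial (Fin n × Fin n) ℂ))
        (rename (fun av : Fin 1 × Fin n => av.2) g) := by
  have hfun : ((fun v : Fin n => (X (ρ 0, v) : MvPolynomial (Fin n × Fin n) ℂ)) ∘ fun av : Fin 1 × Fin n => av.2) =
      fun av : Fin 1 × Fin n => (X (ρ av.1, av.2) : MvPolynomial (Fin n × Fin n) ℂ) := by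
    funext av
    simp only [Function.comp_apply]
    rw [Subsingleton.elim av.1 0]
  rw [aeval_rename, hfun]

end FormulaSubstitution

end Summit.ValiantsHypothesis.ValiantsHypothesis.Theorems

end
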